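import Summits.HubbardSuperconductivity.HubbardSuperconductivity.Theorems.AnisotropyChordTransferFibre3Dirichlet

/-!
# Route `AnisotropyChord` / H0 rotor rung: PORT N30-A revised targets — `ShellDirichletBound` PROVED

(MI) ingredient §284(b)(ii) of memo ROTOR-THEORY-20 (theory seat `hubbard-h0-rotor-theory-1`, cycle 20): for `Y` vanishing on
the hard core, `Σ_S W|Y|² ≤ Re⟨Y, H₀Y⟩` — **`shellDirichletBound_holds : ShellDirichletBound L`** (every `L`).
Combinatorial step on top of the hopping-form bound `re_ip_H0apply_ge_cnt` (`…TransferFibre3Dirichlet`): off the hard core every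
nearest-neighbour pair among the three particles provides two of the twelve hops landing in `D`, and the six exhibited hops are
pairwise distinct, so `2·W(c) ≤ cnt(c)` (`two_Wcount_le_cnt`).
Prover seat `hubbard-h0-rotor-p1` g21; helper for stmt-HubbardSuperconductivity-19089 (`--supports`).
-/

set_option linter.dupNamespace false
set_option autoImplicit false

noncomputable section

open scoped BigOperators
open Complex

namespace Summit.HubbardSuperconductivity.HubbardSuperconductivity.Theorems.AnisotropyChord.Transfer.Fibre3

variable (L : ℕ) [NeZero L]

omit [NeZero L] in
/-- a nearest-neighbour vector is one of `±eₓ, ±e_y`. [folklore] -/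
theorem eq_of_isNN {z : Tor L} (h : IsNN L z = true) : z = ex L ∨ z = -ex L ∨ z = ey L ∨ z = -ey L := by
  unfold IsNN at h
  simp only [Bool.or_eq_true, decide_eq_true_eq] at h
  rcases h with ((h | h) | h) | h
  · exact Or.inl h
  · rw [neg_ex] at h; exact Or.inr (Or.inl h)
  · exact Or.inr (Or.inr (Or.inl h))
  · rw [neg_ey] at h; exact Or.inr (Or.inr (Or.inr h))

omit [NeZero L] in
/-- **two marked slots:** if `x ≠ y` and each of them, when a nearest-neighbour vector, marks a slot of weight `≥ 1`, then
`[x nn] + [y nn] ≤ t(eₓ) + t(−eₓ) + t(e_y) + t(−e_y)` for nonnegative `t`. [folklore] -/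
theorem count2 (t : Tor L → ℝ) (hn : ∀ e, 0 ≤ t e) {x y : Tor L} (hxy : x ≠ y)
    (hx : IsNN L x = true → 1 ≤ t x) (hy : IsNN L y = true → 1 ≤ t y) :
    ((if IsNN L x = true then 1 else 0 : ℝ) + (if IsNN L y = true then 1 else 0 : ℝ))
      ≤ t (ex L) + t (-ex L) + t (ey L) + t (-ey L) := by
  have h0 := hn (ex L); have h1 := hn (-ex L); have h2 := hn (ey L); have h3 := hn (-ey L)
  by_cases hX : IsNN L x = true
  · have tx := hx hX
    by_cases hY : IsNN L y = true
    · rw [if_pos hX, if_pos hY]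
      have ty := hy hY
      rcases eq_of_isNN L hX with rfl | rfl | rfl | rfl <;> rcases eq_of_isNN L hY with rfl | rfl | rfl | rfl <;>
        first | exact (hxy rfl).elim | linarith
    · rw [if_pos hX, if_neg hY]
      rcases eq_of_isNN L hX with rfl | rfl | rfl | rfl <;> linarith
  · by_cases hY : IsNN L y = true
    · rw [if_neg hX, if_pos hY]
      have ty := hy hY
      rcases eq_of_isNN L hY with rfl | rfl | rfl | rfl <;> linarith
    · rw [if_neg hX, if_neg hY]; linarith

omit [NeZero L] in
/-- [folklore] -/
theorem Dind_eq_one_of {d : Cfg L} (h : InD L d = true) : Dind L d = 1 := by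
  unfold Dind; simp [h]

omit [NeZero L] in
/-- **off the hard core, `2·W(c) ≤ cnt(c)`:** each nearest-neighbour pair gives two hops into `D`
(pair 23, `b − a = e`: `(a+e,b) = (b,b)`, `(a,b−e) = (a,a)`; pair 12, `a = e`: `(a−e,b) = (0,b)`, `(a−e,b−e) = (0,b−a)`;
pair 13, `b = e`: `(a,b−e) = (a,0)`, `(a−e,b−e) = (a−b,0)`), and the six slots are pairwise distinct. [folklore] -/
theorem two_Wcount_le_cnt (c : Cfg L) (hc : InD L c = false) : 2 * (Wcount L c : ℝ) ≤ cnt L c := by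
  obtain ⟨a, b⟩ := c
  have hD : (¬(a = 0) ∧ ¬(b = 0)) ∧ ¬(a = b) := by unfold InD at hc; simpa using hc
  obtain ⟨⟨ha, hb⟩, hab⟩ := hD
  -- type-1 hops `(a+e, b)`: slots `e = −a` (pair 12) and `e = b − a` (pair 23)
  have T1 := count2 L (fun e => Dind L (((a, b) : Cfg L) + (e, 0))) (fun e => Dind_nonneg L _)
    (x := -a) (y := b - a)
    (by intro h; apply hb; have h2 : b = (b - a) + a := (sub_add_cancel b a).symm
        rw [← h, neg_add_cancel] at h2; exact h2)
    (fun _ => by rw [Dind_eq_one_of]; unfold InD; simp)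
    (fun _ => by rw [Dind_eq_one_of]; unfold InD; simp)
  -- type-2 hops `(a, b+e)`: slots `e = −b` (pair 13) and `e = a − b` (pair 23)
  have T2 := count2 L (fun e => Dind L (((a, b) : Cfg L) + (0, e))) (fun e => Dind_nonneg L _)
    (x := -b) (y := a - b)
    (by intro h; apply ha; have h2 : a = (a - b) + b := (sub_add_cancel a b).symm
        rw [← h, neg_add_cancel] at h2; exact h2)
    (fun _ => by rw [Dind_eq_one_of]; unfold InD; simp)
    (fun _ => by rw [Dind_eq_one_of]; unfold InD; simp)
  -- type-3 hops `(a−e, b−e)`: slots `e = a` (pair 12) and `e = b` (pair 13)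
  have T3 := count2 L (fun e => Dind L (((a, b) : Cfg L) + (-e, -e))) (fun e => Dind_nonneg L _)
    (x := a) (y := b) hab
    (fun _ => by rw [Dind_eq_one_of]; unfold InD; simp)
    (fun _ => by rw [Dind_eq_one_of]; unfold InD; simp)
  simp only [IsNN_neg] at T1 T2
  rw [← neg_sub b a, IsNN_neg] at T2
  simp only [neg_neg] at T3
  unfold cnt
  simp only [Wcount, Nat.cast_add, Nat.cast_ite, Nat.cast_one, Nat.cast_zero]
  linarith

/-- **`ShellDirichletBound` holds** (every `L`): `Σ_c W(c)‖Y c‖² ≤ Re⟨Y, H₀Y⟩` for `Y` vanishing on the hard core. [folklore] -/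
theorem shellDirichletBound_holds : ShellDirichletBound L := by
  intro Y hY
  refine le_trans ?_ (re_ip_H0apply_ge_cnt L Y hY)
  rw [Finset.mul_sum]
  apply Finset.sum_le_sum
  intro c _
  by_cases hc : InD L c = true
  · rw [hY c hc]; simp
  · have hc' : InD L c = false := by simpa using hc
    have h2 := two_Wcount_le_cnt L c hc'
    nlinarith [sq_nonneg ‖Y c‖]

end Summit.HubbardSuperconductivity.HubbardSuperconductivity.Theorems.AnisotropyChord.Transfer.Fibre3

end
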